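import Mathlib
import HarnessLib

/-!
# `ContinuumFromLatticeGap` (stmt-QuantumFields-15915), line `registered` (reshape 6): `stub_volumeChoice`

Support file for the crux item stmt-QuantumFields-15915
(`Summit.QuantumFields.YangMills.Theses.GronwallGap.ContinuumFromLatticeGap`), registered stub
`stub_volumeChoice` of the line `registered` (reshape 6): **the volume choice**.

**Statement.** Given lattice spacings `a k > 0` (with `a k → 0`, unused), a threshold sequence `T : ℕ → ℕ`
and constants `C n d`, there is a volume floor `L₀ : ℕ → ℕ` such that EVERY `L ≥ L₀` dominates `T`, has
polynomial growth (`(a k)⁻¹ ≤ (a k * L k) ^ N` eventually, here with `N = 1` and for all `k`), and absorbs the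
constants at every arity `n` and radius `ρ`:
`(log (max 1 (C n (⌊ρ / a k⌋₊ + 2))) + |log (a k)|) / (a k * L k) → 0`.

**Proof.** Diagonal choice over the countably many `(n, ρ)`: with
`M k := ∑ n ≤ k, ∑ ρ ≤ k, log (max 1 (C n (⌊ρ / a k⌋₊ + 2)))` (a sum of non-negative terms, hence above each
of them) and `B k := (k + 1) * (|log (a k)| + M k) + (a k)⁻¹`, put `L₀ k := max (T k) ⌈B k / a k⌉₊`.  For
`L ≥ L₀` one gets `B k ≤ a k * L k`, whence `T ≤ L`, `(a k)⁻¹ ≤ a k * L k`, and for `k ≥ max n ρ` the ratio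
lies in `[0, 1 / (k + 1)]`, so it tends to `0` by squeezing (`tendsto_one_div_add_atTop_nhds_zero_nat`).

No definitions, no facts; Mathlib only (pure real analysis). [folklore]
-/

noncomputable section

namespace Summit.QuantumFields.YangMills.Theorems.ContinuumFromLatticeGap

open Filter Topology

/-- **The volume choice** (stub `stub_volumeChoice` of the line `registered`, reshape 6, of
stmt-QuantumFields-15915).  Given spacings `a k > 0`, a threshold sequence `T` and constants `C n d`, there is
a volume floor `L₀` such that EVERY `L ≥ L₀` dominates `T`, has polynomial growth (`(a k)⁻¹ ≤ (a k * L k) ^ N`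
eventually) and absorbs the constants at every arity and radius:
`(log (max 1 (C n (⌊ρ / a k⌋₊ + 2))) + |log (a k)|) / (a k * L k) → 0` for all `n ρ : ℕ`.  Diagonal choice:
`a k * L₀ k ≥ (k + 1) * (|log (a k)| + ∑_{n, ρ ≤ k} log (max 1 (C n (⌊ρ / a k⌋₊ + 2)))) + (a k)⁻¹` and
`L₀ ≥ T`; then the ratio lies in `[0, 1 / (k + 1)]` for `k ≥ max n ρ`. [folklore] -/
theorem stub_volumeChoice :
    ∀ (a : ℕ → ℝ) (T : ℕ → ℕ) (C : ℕ → ℕ → ℝ), (∀ k, 0 < a k) → Tendsto a atTop (𝓝 0) →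
      ∃ L₀ : ℕ → ℕ, ∀ L : ℕ → ℕ, (∀ k, L₀ k ≤ L k) →
        (∀ k, T k ≤ L k) ∧ (∃ N : ℕ, 1 ≤ N ∧ ∀ᶠ k in atTop, (a k)⁻¹ ≤ (a k * (L k : ℝ)) ^ N) ∧
        ∀ n ρ : ℕ, Tendsto (fun k => (Real.log (max 1 (C n (⌊(ρ : ℝ) / a k⌋₊ + 2))) + |Real.log (a k)|) /
          (a k * (L k : ℝ))) atTop (𝓝 0) := by
  intro a T C ha _
  -- the constants to absorb at step `k`: all arities `n ≤ k` and radii `ρ ≤ k`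
  set M : ℕ → ℝ := fun k => ∑ n ∈ Finset.range (k + 1), ∑ ρ ∈ Finset.range (k + 1),
    Real.log (max 1 (C n (⌊(ρ : ℝ) / a k⌋₊ + 2))) with hM
  -- the target lower bound for the physical volume `a k * L k`
  set B : ℕ → ℝ := fun k => ((k : ℝ) + 1) * (|Real.log (a k)| + M k) + (a k)⁻¹ with hB
  have hlog0 : ∀ n d : ℕ, 0 ≤ Real.log (max 1 (C n d)) := fun n d => Real.log_nonneg (le_max_left _ _)
  have hM0 : ∀ k, 0 ≤ M k := fun k =>
    Finset.sum_nonneg fun n _ => Finset.sum_nonneg fun ρ _ => hlog0 _ _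
  have hB0 : ∀ k, (a k)⁻¹ ≤ B k := fun k =>
    le_add_of_nonneg_left (mul_nonneg (by positivity) (add_nonneg (abs_nonneg _) (hM0 k)))
  refine ⟨fun k => max (T k) ⌈B k / a k⌉₊, fun L hL => ?_⟩
  -- the key lower bound on the physical volume
  have hBL : ∀ k, B k ≤ a k * (L k : ℝ) := fun k => by
    have h1 : B k / a k ≤ (L k : ℝ) :=
      (Nat.le_ceil _).trans (by exact_mod_cast (le_max_right _ _).trans (hL k))
    rw [div_le_iff₀ (ha k)] at h1
    linarith [h1]
  have hpos : ∀ k, 0 < a k * (L k : ℝ) := fun k =>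
    (inv_pos.mpr (ha k)).trans_le ((hB0 k).trans (hBL k))
  refine ⟨fun k => (le_max_left _ _).trans (hL k), ⟨1, le_rfl, Eventually.of_forall fun k => ?_⟩,
    fun n ρ => ?_⟩
  · rw [pow_one]
    exact (hB0 k).trans (hBL k)
  · refine tendsto_of_tendsto_of_tendsto_of_le_of_le' tendsto_const_nhds
      tendsto_one_div_add_atTop_nhds_zero_nat (Eventually.of_forall fun k => ?_) ?_
    · exact div_nonneg (add_nonneg (hlog0 _ _) (abs_nonneg _)) (hpos k).le
    · filter_upwards [eventually_ge_atTop (max n ρ)] with k hk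
      have hn : n ∈ Finset.range (k + 1) := Finset.mem_range.mpr (Nat.lt_succ_of_le (le_of_max_le_left hk))
      have hρ : ρ ∈ Finset.range (k + 1) :=
        Finset.mem_range.mpr (Nat.lt_succ_of_le (le_of_max_le_right hk))
      -- the single term is dominated by the (double) sum of non-negative terms
      have hterm : Real.log (max 1 (C n (⌊(ρ : ℝ) / a k⌋₊ + 2))) ≤ M k :=
        calc Real.log (max 1 (C n (⌊(ρ : ℝ) / a k⌋₊ + 2)))
            ≤ ∑ ρ' ∈ Finset.range (k + 1), Real.log (max 1 (C n (⌊(ρ' : ℝ) / a k⌋₊ + 2))) :=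
              Finset.single_le_sum (f := fun ρ' : ℕ => Real.log (max 1 (C n (⌊(ρ' : ℝ) / a k⌋₊ + 2))))
                (fun ρ' _ => hlog0 _ _) hρ
          _ ≤ M k :=
              Finset.single_le_sum (f := fun n' : ℕ => ∑ ρ' ∈ Finset.range (k + 1),
                Real.log (max 1 (C n' (⌊(ρ' : ℝ) / a k⌋₊ + 2))))
                (fun n' _ => Finset.sum_nonneg fun ρ' _ => hlog0 _ _) hn
      rw [div_le_div_iff₀ (hpos k) (by positivity), one_mul]
      calc (Real.log (max 1 (C n (⌊(ρ : ℝ) / a k⌋₊ + 2))) + |Real.log (a k)|) * ((k : ℝ) + 1)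
          ≤ (M k + |Real.log (a k)|) * ((k : ℝ) + 1) := by gcongr
        _ = ((k : ℝ) + 1) * (|Real.log (a k)| + M k) := by ring
        _ ≤ B k := le_add_of_nonneg_right (inv_pos.mpr (ha k)).le
        _ ≤ a k * (L k : ℝ) := hBL k

end Summit.QuantumFields.YangMills.Theorems.ContinuumFromLatticeGap
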